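import Literature.Computability.AlgebraicComplexity.SupportEntropy
import Literature.Computability.AlgebraicComplexity.EchelonRows
import HarnessLib

/-!
# Strassen's upper support functional in flag form: the lower bound for antichain supports

Topic `Literature/Computability/AlgebraicComplexity`. The comparison "upper support functional ≥
lower support functional" of Strassen ([Str91]; CVZ 2023, Thm. 2.15) in the special case the barrier
of CLLZ 2025 consumes: if the support of `t` in the given (ordered) bases is an *antichain* for the
product of three linear orders (so every support point is maximal; `t` is *oblique*, CVZ Def. 2.18),
then for EVERY frame `(A, B, C)` (three spanning families of rows indexed by `Fin Nᵢ`) the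
down-closed support `cl supp((A ⊗ B ⊗ C)·t) = {x | ∃ y ∈ supp((A ⊗ B ⊗ C)·t), x ≤ y}` has
`θ`-entropy at least `H_θ(supp t)`:
`maxWeightedEntropy_support_le_frame_of_isAntichain`. With the flag characterisation of `ρ^θ`
(CVZ Prop. 2.6, Lemma 2.13) this is `ρ^θ(t) ≥ H_θ(supp t)`, i.e. `ζ^θ(t) = 2^{H_θ(supp t)}` for oblique
`t` (CVZ Thm. 2.19); only the inequality for frames is proved and used here.

## Proof (CVZ Prop. 2.16, written for spanning families instead of flags)

* `exists_pivotMap` — for a spanning family `d : Fin N → K^ι` and a linear order on `ι`, the map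
  `φ(β) = max {k | some u ∈ span{d_α : α ≥ k} has u(β) = 1 and u(β') = 0 for β' < β}` is injective
  (CVZ (2.3) and the injectivity argument following it: if `β < γ` had the same `k`, eliminating the
  `d_k`-component between the two witnesses would make `k + 1` admissible for `β`).
* For a support point `β = (β₁, β₂, β₃)` with witnesses `u₁, u₂, u₃`: by maximality of `β` in the
  support, `∑ u₁(a) u₂(b) u₃(c) t_{abc} = t_β ≠ 0` (`sum₃_eq_of_isAntichain`), while expanding the
  `uᵢ` in the rows `≥ φᵢ(βᵢ)` (trilinearity, `sum₃_linear₁/₂/₃`) exhibits a support point of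
  `(A ⊗ B ⊗ C)·t` dominating `(φ₁ β₁, φ₂ β₂, φ₃ β₃)`; conclude by transport
  (`maxWeightedEntropy_le_of_injOn`).

No definitions are introduced.

## References

* V. Strassen, J. reine angew. Math. 413 (1991) — cited through CVZ.
* M. Christandl, P. Vrana, J. Zuiddam, J. Amer. Math. Soc. 36 (2023), Prop. 2.16, Thm. 2.15,
  Def. 2.18, Thm. 2.19. [ChristandlVranaZuiddam2023]
-/

noncomputable section

open scoped BigOperators

namespace Literature.Computability.AlgebraicComplexity

/-! ## The pivot map of a spanning family with respect to a linear order (CVZ Prop. 2.16) -/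

section Pivot

variable {K : Type*} [Field K] {ι : Type*} [LinearOrder ι] {N : ℕ}

/-- Tails of a family: the index set `{α | k ≤ α}` is `{k} ∪ {α | k + 1 ≤ α}` for `k < N`. [folklore] -/
theorem setOf_le_val_eq_insert {k : ℕ} (hk : k < N) :
    {α : Fin N | k ≤ α.val} = insert ⟨k, hk⟩ {α : Fin N | k + 1 ≤ α.val} := by
  ext α
  simp only [Set.mem_setOf_eq, Set.mem_insert_iff]
  constructor
  · intro h
    rcases Nat.eq_or_lt_of_le h with h' | h'
    · exact Or.inl (Fin.ext h'.symm)
    · exact Or.inr h'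
  · rintro (rfl | h)
    · exact le_rfl
    · exact Nat.le_of_succ_le h

omit [LinearOrder ι] in
/-- Beyond the last index the tail span is trivial. [folklore] -/
theorem span_image_tail_eq_bot (d : Fin N → ι → K) {k : ℕ} (hk : N ≤ k) :
    Submodule.span K (d '' {α : Fin N | k ≤ α.val}) = ⊥ := by
  have : {α : Fin N | k ≤ α.val} = ∅ := by
    ext α
    simp only [Set.mem_setOf_eq, Set.mem_empty_iff_false, iff_false, not_le]
    exact lt_of_lt_of_le α.isLt hk
  rw [this, Set.image_empty, Submodule.span_empty]

omit [LinearOrder ι] in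
/-- A vector in the `k`-th tail span splits off its `d_k`-component: `u = c • d_k + u'` with `u'`
in the `(k+1)`-st tail span. [folklore] -/
theorem exists_smul_add_of_mem_span_tail (d : Fin N → ι → K) {k : ℕ} (hk : k < N) {u : ι → K}
    (hu : u ∈ Submodule.span K (d '' {α : Fin N | k ≤ α.val})) :
    ∃ (c : K) (u' : ι → K), u' ∈ Submodule.span K (d '' {α : Fin N | k + 1 ≤ α.val}) ∧
      u = c • d ⟨k, hk⟩ + u' := by
  rw [setOf_le_val_eq_insert hk, Set.image_insert_eq, Submodule.mem_span_insert] at hu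
  obtain ⟨c, u', hu', rfl⟩ := hu
  exact ⟨c, u', hu', rfl⟩

/-- **The injective pivot map** (CVZ Prop. 2.16, first half): for a family `d : Fin N → K^ι` spanning
`K^ι` and a linear order on `ι` there is an injective `φ : ι → Fin N` such that for every `β` some
vector `u` in the tail span `span {d_α | α ≥ φ(β)}` has `u(β) = 1` and `u(β') = 0` for all `β' < β`
(`φ(β)` is the largest such tail; if `β < γ` had the same value `k`, a combination of the two
witnesses would lie in the `(k+1)`-st tail, be `1` at `β` and vanish below `β`).
[cite: ChristandlVranaZuiddam2023, Prop. 2.16] -/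
theorem exists_pivotMap (d : Fin N → ι → K) (hd : Submodule.span K (Set.range d) = ⊤) :
    ∃ φ : ι → Fin N, Function.Injective φ ∧
      ∀ β, ∃ u ∈ Submodule.span K (d '' {α : Fin N | (φ β).val ≤ α.val}),
        u β = 1 ∧ ∀ β' < β, u β' = 0 := by
  classical
  -- admissibility of a tail for `β`
  let Adm : ι → ℕ → Prop := fun β k =>
    ∃ u ∈ Submodule.span K (d '' {α : Fin N | k ≤ α.val}), u β = 1 ∧ ∀ β' < β, u β' = 0
  have hAdm0 : ∀ β, Adm β 0 := by
    intro β
    refine ⟨Pi.single β 1, ?_, Pi.single_eq_same β 1, fun β' h => Pi.single_eq_of_ne h.ne _⟩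
    have : d '' {α : Fin N | 0 ≤ α.val} = Set.range d := by
      rw [← Set.image_univ]
      congr 1
      ext α
      simp
    rw [this, hd]
    exact Submodule.mem_top
  have hAdmN : ∀ β k, N ≤ k → ¬Adm β k := by
    rintro β k hk ⟨u, hu, hu1, -⟩
    rw [span_image_tail_eq_bot d hk, Submodule.mem_bot] at hu
    rw [hu] at hu1
    exact one_ne_zero (hu1.symm.trans (Pi.zero_apply β))
  -- the largest admissible tail
  have hlt : ∀ β, Nat.findGreatest (Adm β) N < N := by
    intro β
    refine lt_of_le_of_ne (Nat.findGreatest_le N) fun h => ?_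
    have hspec : Adm β (Nat.findGreatest (Adm β) N) := Nat.findGreatest_spec (Nat.zero_le N) (hAdm0 β)
    rw [h] at hspec
    exact hAdmN β N le_rfl hspec
  let φ : ι → Fin N := fun β => ⟨Nat.findGreatest (Adm β) N, hlt β⟩
  have hφ : ∀ β, (φ β).val = Nat.findGreatest (Adm β) N := fun β => rfl
  have hspec : ∀ β, Adm β (φ β).val := fun β => Nat.findGreatest_spec (Nat.zero_le N) (hAdm0 β)
  have hmax : ∀ β k, (φ β).val < k → ¬Adm β k := by
    intro β k hk
    by_cases hkN : k ≤ N
    · exact Nat.findGreatest_is_greatest hk hkN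
    · exact hAdmN β k (le_of_not_ge hkN)
  -- injectivity
  have key : ∀ β γ, β < γ → (φ β).val = (φ γ).val → False := by
    intro β γ hβγ heq
    set k := (φ β).val with hkdef
    have hkN : k < N := (φ β).isLt
    obtain ⟨u, hu, hu1, hu0⟩ := hspec β
    obtain ⟨w, hw, hw1, hw0⟩ := hspec γ
    rw [← heq] at hw
    obtain ⟨cu, u', hu', rfl⟩ := exists_smul_add_of_mem_span_tail d hkN hu
    obtain ⟨cw, w', hw', hw_eq⟩ := exists_smul_add_of_mem_span_tail d hkN hw
    by_cases hcw : cw = 0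
    · -- `w = w'` lies in the next tail: `k + 1` is admissible for `γ`
      rw [hcw, zero_smul, zero_add] at hw_eq
      refine hmax γ (k + 1) (heq ▸ Nat.lt_succ_self k) ⟨w, hw_eq ▸ hw', hw1, hw0⟩
    · -- eliminate the `d_k`-component: `u - (cu / cw) • w` lies in the next tail
      have hv : (cu • d ⟨k, hkN⟩ + u') - (cu / cw) • w = u' - (cu / cw) • w' := by
        rw [hw_eq, smul_add, smul_smul, div_mul_cancel₀ cu hcw]
        abel
      refine hmax β (k + 1) (Nat.lt_succ_self k) ⟨(cu • d ⟨k, hkN⟩ + u') - (cu / cw) • w, ?_, ?_, ?_⟩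
      · rw [hv]
        exact Submodule.sub_mem _ hu' (Submodule.smul_mem _ _ hw')
      · simp only [Pi.sub_apply, Pi.smul_apply, smul_eq_mul]
        rw [hu1, hw0 β hβγ, mul_zero, sub_zero]
      · intro β' hβ'
        simp only [Pi.sub_apply, Pi.smul_apply, smul_eq_mul]
        rw [hu0 β' hβ', hw0 β' (hβ'.trans hβγ), mul_zero, sub_zero]
  refine ⟨φ, fun β γ h => ?_, fun β => hspec β⟩
  by_contra hne
  rcases lt_or_gt_of_ne hne with hlt' | hlt'
  · exact key β γ hlt' (congrArg Fin.val h)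
  · exact key γ β hlt' (congrArg Fin.val h).symm

end Pivot

/-! ## Evaluation at the witnesses of a maximal support point -/

section Evaluate

variable {K : Type*} [Field K] {ι κ μ : Type*} [LinearOrder ι] [LinearOrder κ] [LinearOrder μ]
  [Fintype ι] [Fintype κ] [Fintype μ]

/-- If the support of `t` is an antichain and `β = (β₁, β₂, β₃)` is a support point, then vectors
`uᵢ` with `uᵢ(βᵢ) = 1` vanishing below `βᵢ` evaluate `t` to `t_β`: all other terms of
`∑ u₁(a) u₂(b) u₃(c) t_{abc}` vanish, those with a coordinate below `β` by the `uᵢ`, the others by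
maximality of `β` (CVZ, proof of Prop. 2.16: "Since `β` is a maximal element … the sum over `β' > β`
equals zero"). [cite: ChristandlVranaZuiddam2023, Prop. 2.16 (proof)] -/
theorem sum₃_eq_of_isAntichain (t : ι → κ → μ → K) (hanti : IsAntichain (· ≤ ·) (tensorSupport t))
    {β₁ : ι} {β₂ : κ} {β₃ : μ} (hβ : (β₁, β₂, β₃) ∈ tensorSupport t) {u₁ : ι → K} {u₂ : κ → K}
    {u₃ : μ → K} (h₁ : u₁ β₁ = 1) (h₁' : ∀ β' < β₁, u₁ β' = 0) (h₂ : u₂ β₂ = 1)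
    (h₂' : ∀ β' < β₂, u₂ β' = 0) (h₃ : u₃ β₃ = 1) (h₃' : ∀ β' < β₃, u₃ β' = 0) :
    (∑ a, ∑ b, ∑ c, u₁ a * u₂ b * u₃ c * t a b c) = t β₁ β₂ β₃ := by
  -- every term other than the one at `β` vanishes
  have hterm : ∀ a b c, (a, b, c) ≠ (β₁, β₂, β₃) → u₁ a * u₂ b * u₃ c * t a b c = 0 := by
    intro a b c hne
    by_cases ha : u₁ a = 0
    · simp [ha]
    by_cases hb : u₂ b = 0
    · simp [hb]
    by_cases hc : u₃ c = 0
    · simp [hc]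
    have ha' : β₁ ≤ a := not_lt.1 fun h => ha (h₁' a h)
    have hb' : β₂ ≤ b := not_lt.1 fun h => hb (h₂' b h)
    have hc' : β₃ ≤ c := not_lt.1 fun h => hc (h₃' c h)
    by_cases ht : t a b c = 0
    · simp [ht]
    exact absurd (show ((β₁, β₂, β₃) : ι × κ × μ) ≤ (a, b, c) from ⟨ha', hb', hc'⟩)
      (hanti hβ (show ((a, b, c) : ι × κ × μ) ∈ tensorSupport t from ht) (Ne.symm hne))
  rw [Finset.sum_eq_single β₁, Finset.sum_eq_single β₂, Finset.sum_eq_single β₃]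
  · rw [h₁, h₂, h₃]
    ring
  · exact fun c _ hc => hterm _ _ _ fun h => hc (by simpa using h)
  · simp
  · exact fun b _ hb => Finset.sum_eq_zero fun c _ => hterm _ _ _ fun h => hb (by
      simp only [Prod.mk.injEq] at h
      exact h.2.1)
  · simp
  · exact fun a _ ha => Finset.sum_eq_zero fun b _ => Finset.sum_eq_zero fun c _ =>
      hterm _ _ _ fun h => ha (by
        simp only [Prod.mk.injEq] at h
        exact h.1)
  · simp

end Evaluate

/-! ## The lower bound for antichain supports, frame by frame -/

section Antichain

variable {K : Type*} [Field K] {ι κ μ : Type*} [LinearOrder ι] [LinearOrder κ] [LinearOrder μ]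
  [Fintype ι] [Fintype κ] [Fintype μ]

/-- **Antichain supports bound every frame from below** (Strassen's comparison `ρ^θ ≥ ρ_θ`, CVZ
Thm. 2.15 with Prop. 2.16, for oblique supports, Thm. 2.19 — in flag form, frame by frame): if
`supp t` is an antichain for the product of three linear orders, then for `θ ≥ 0` and every frame
`(A, B, C)` with spanning rows, `H_θ(supp t) ≤ H_θ(cl supp((A ⊗ B ⊗ C)·t))`, the down-closure taken
in the product of the three `Fin` orders. [cite: ChristandlVranaZuiddam2023, Thm. 2.15 and Prop. 2.16] -/
theorem maxWeightedEntropy_support_le_frame_of_isAntichain (t : ι → κ → μ → K)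
    (hanti : IsAntichain (· ≤ ·) (tensorSupport t)) {N₁ N₂ N₃ : ℕ} (A : Matrix (Fin N₁) ι K)
    (B : Matrix (Fin N₂) κ K) (C : Matrix (Fin N₃) μ K)
    (hA : Submodule.span K (Set.range A.row) = ⊤) (hB : Submodule.span K (Set.range B.row) = ⊤)
    (hC : Submodule.span K (Set.range C.row) = ⊤) {θ : Fin 3 → ℝ} (hθ : ∀ i, 0 ≤ θ i) :
    maxWeightedEntropy θ (tensorSupport t) ≤
      maxWeightedEntropy θ {x | ∃ y ∈ tensorSupport (actTensor A B C t), x ≤ y} := by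
  classical
  obtain ⟨φ₁, hφ₁, hu₁⟩ := exists_pivotMap (fun i => A i) hA
  obtain ⟨φ₂, hφ₂, hu₂⟩ := exists_pivotMap (fun i => B i) hB
  obtain ⟨φ₃, hφ₃, hu₃⟩ := exists_pivotMap (fun i => C i) hC
  refine maxWeightedEntropy_le_of_injOn hθ φ₁ φ₂ φ₃ hφ₁.injOn hφ₂.injOn hφ₃.injOn ?_
  rintro ⟨β₁, β₂, β₃⟩ hβ
  obtain ⟨u₁, hu₁m, h₁, h₁'⟩ := hu₁ β₁
  obtain ⟨u₂, hu₂m, h₂, h₂'⟩ := hu₂ β₂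
  obtain ⟨u₃, hu₃m, h₃, h₃'⟩ := hu₃ β₃
  -- the evaluation at the witnesses is `t_β ≠ 0`
  have hE : (∑ a, ∑ b, ∑ c, u₁ a * u₂ b * u₃ c * t a b c) ≠ 0 := by
    rw [sum₃_eq_of_isAntichain t hanti hβ h₁ h₁' h₂ h₂' h₃ h₃']
    exact hβ
  -- coefficients of the witnesses in the tails
  set T₁ := {α : Fin N₁ // (φ₁ β₁).val ≤ α.val} with hT₁
  set T₂ := {α : Fin N₂ // (φ₂ β₂).val ≤ α.val} with hT₂
  set T₃ := {α : Fin N₃ // (φ₃ β₃).val ≤ α.val} with hT₃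
  have him₁ : (fun i => A i) '' {α : Fin N₁ | (φ₁ β₁).val ≤ α.val} = Set.range fun α : T₁ => A α :=
    Set.image_eq_range _ _
  have him₂ : (fun i => B i) '' {α : Fin N₂ | (φ₂ β₂).val ≤ α.val} = Set.range fun α : T₂ => B α :=
    Set.image_eq_range _ _
  have him₃ : (fun i => C i) '' {α : Fin N₃ | (φ₃ β₃).val ≤ α.val} = Set.range fun α : T₃ => C α :=
    Set.image_eq_range _ _
  rw [him₁] at hu₁m
  rw [him₂] at hu₂m
  rw [him₃] at hu₃m
  obtain ⟨c₁, hc₁⟩ := (Submodule.mem_span_range_iff_exists_fun K).1 hu₁m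
  obtain ⟨c₂, hc₂⟩ := (Submodule.mem_span_range_iff_exists_fun K).1 hu₂m
  obtain ⟨c₃, hc₃⟩ := (Submodule.mem_span_range_iff_exists_fun K).1 hu₃m
  have e₁ : ∀ a, u₁ a = ∑ α : T₁, c₁ α * A α a := fun a => by
    have h := congrFun hc₁ a
    simp only [Finset.sum_apply, Pi.smul_apply, smul_eq_mul] at h
    exact h.symm
  have e₂ : ∀ b, u₂ b = ∑ α : T₂, c₂ α * B α b := fun b => by
    have h := congrFun hc₂ b
    simp only [Finset.sum_apply, Pi.smul_apply, smul_eq_mul] at h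
    exact h.symm
  have e₃ : ∀ c, u₃ c = ∑ α : T₃, c₃ α * C α c := fun c => by
    have h := congrFun hc₃ c
    simp only [Finset.sum_apply, Pi.smul_apply, smul_eq_mul] at h
    exact h.symm
  -- expand by trilinearity: a nonzero term exhibits a dominating support point of `(A ⊗ B ⊗ C)·t`
  simp only [e₁, e₂, e₃] at hE
  rw [sum₃_linear₁] at hE
  obtain ⟨α₁, -, hα₁⟩ := Finset.exists_ne_zero_of_sum_ne_zero hE
  rw [sum₃_linear₂, mul_ne_zero_iff] at hα₁
  obtain ⟨α₂, -, hα₂⟩ := Finset.exists_ne_zero_of_sum_ne_zero hα₁.2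
  rw [sum₃_linear₃, mul_ne_zero_iff] at hα₂
  obtain ⟨α₃, -, hα₃⟩ := Finset.exists_ne_zero_of_sum_ne_zero hα₂.2
  rw [mul_ne_zero_iff, ← actTensor_apply] at hα₃
  refine ⟨((α₁ : Fin N₁), (α₂ : Fin N₂), (α₃ : Fin N₃)), hα₃.2, ?_⟩
  exact ⟨Fin.le_def.2 α₁.2, Fin.le_def.2 α₂.2, Fin.le_def.2 α₃.2⟩

end Antichain

end Literature.Computability.AlgebraicComplexity

end
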